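import Summits.QuantumFields.YangMills.Theorems.FluctuationComparisonRegPrIntLOrganTangentPullbackSquareCurv
import Summits.QuantumFields.YangMills.Theorems.FluctuationComparisonRegPrIntLOrganTangentSeedHClause
import HarnessLib

/-!
# Crux `FluctuationComparisonRegPrIntL` (stmt-QuantumFields-20520, rung R3), PATH-B organ — «JT-CURV» (N3), ORGAN EDITION in shape (s2):
# AN `HClauseSq`-SHAPED PAIR CLAUSE FROM A DIFFERENTIAL CURVATURE-INDEXED SQUARE CLAUSE ALONG THE ORGAN'S ONE-BOND EXPONENTIAL SQUARES (DEFINITION-FREE)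

Cell `ym3-torus` (YM ladder rung R3 = continuum `SU(2)` Yang–Mills on the three-torus — a RUNG: NOT d = 4, NOT infinite volume, NOT a mass gap, NOT Clay).
Width seat `ym3-torus-px19` (gen 20); LEAD w3 g26 №10 (1) GO «JT-CURV» and №15 (2) RULING (Q-SPEED) = **(s2)**: «the organ edition quantifies ONLY the chart's own
two-parameter families `W(s,t) := Φ(U·expPt(s•m)@B·expPt(t•m′)@B′, z)` — exactly the squares (JT-h) integrates»; LOCATE `HOME/ym3-torus-px19/g20/LOCATE-JT-DISCHARGER-DOOR-px19g20.md`
a69adec5 §4; `--kind proof --supports stmt-QuantumFields-20520 --as helper`, count-neutral, no registry ∕ binder ∕ `Lines/` edit, default heartbeats, `autoImplicit false`.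

WHAT.  For a functional `RT : GaugeField P j SU(2) → ℝ` on the COARSE torus (in the discharge: `RT := h_Ts ∘ Φ(·, z)`, the pinned fine functional read through the stride's
chart at a fibre point `z ∈ supp ŵ_t(Xw,·)`), the organ's one-bond exponential SQUARE FAMILY
`sq U b v b′ v′ s t := update (update U b (U b·expPt(s•v))) b′ ((update U b (U b·expPt(s•v))) b′·expPt(t•v′))`, `(s,t) ∈ [0,1]²`
(corners `(0,0) = U`, `(1,0) = U·e^{v}@b`, `(0,1) = U·e^{v′}@b′`, `(1,1) = U·e^{v}@b·e^{v′}@b′` — ✓`OrganTangentSeedHClause.corner_*`), and the HYPOTHESIS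
«DIFFERENTIAL CURVATURE SQUARE CLAUSE» (shape (s2)): for every admissible square (`‖v‖, ‖v′‖ ≤ rc·θc`, the four corners `PlaqSmall θc`) the real function
`F s t := RT (sq … s t)` carries `t`-derivatives at `s = 0, 1`, an `s`-derivative of `∂_t F` on `[0,1]²`, and the STRUCTURED bound
`|∂_s∂_t F| ≤ Σ_{p q : ιP} α p s t·k̃ p q·α′ q s t + Σ_p g̃ p·γ p s t` with plaquette-indexed letters `k̃, g̃ ≥ 0` and profiles
`0 ≤ α ≤ KP p b·(‖v‖∕θc)`, `0 ≤ α′ ≤ KP q b′·(‖v′‖∕θc)`, `0 ≤ γ ≤ KP2 p b b′·(‖v‖∕θc)·(‖v′‖∕θc)` (the chart's plaquette SPEED ∕ ACCELERATION letters per unit normalised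
move) — CONCLUSION ★★`hClauseSq_of_curvSquare`: the `HClauseSq θc rc k′ RT` TEXT (V18DraftTexts ∕ `Lines/runpair_organ.lean` :492, relational corners, VERBATIM binder shape)
with the CURVATURE LETTERS `k′ b b′ := Σ_{p q} KP p b·k̃ p q·KP q b′ + Σ_p g̃ p·KP2 p b b′` — whose κ-row mass is ✓`OrganTangentPullbackSquareCurv.rowMass_curvLetters`
(= ✓RM-PB at `C := 1`, `ι := plaquettes`: `≤ NcolP·w̃·NrowP + G̃·NYP`), m-uniform iff `NcolP·NrowP`, `NYP` are (instr-1 FL-23 `Σ_K0`∕`Σ_K1` saturate; the link-indexed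
✓2a∕RM-PB route is ×`L^{2m}`, FL-22b).  Proof = ✓`abs_rectDiff_le_curvLetters` on `[0,1]²` + the corner identifications + `Finset` algebra pulling the sizes out.
A consumer holding the clause closes `HClauseSq θc rc k′ RT` by `exact fun b b' v v' U V W Z => hClauseSq_of_curvSquare … b b' v v' U V W Z` (δ-unfolding).

WHY (s2) (LEAD №15): it is the weakest clause the (JT-h) discharger's integration step consumes; the nonabelian commutator channel (transported loops: a transporter's
link speed enters × `dist1` of the transported plaquette) stays INSIDE the pair `(h_Ts, Φ)`, where [Balaban1985RegularSpaces] Thm 2's gauge controls it (D-1 (β));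
(s1) «all C² families» is ×`L^m` off uniform for transported loops, (s3)'s extra letter has no consumer (px19 Q-SPEED 07:06Z, LOCATE §3).

INPUTS LEFT TO PRINT (hypotheses here; successor-row material «`SpreadFibreLawHC`», LOCATE §4 (i)–(iii), §5 D-5): the curvature letters `k̃, w̃, g̃` of the pinned `h_Ts`
([Balaban1987RG1] (0.22)–(0.25) + Cauchy in curvature directions) and the chart's `KP, KP2` with the derivative data of `s,t ↦ h_Ts(Φ(sq … s t, z))` ([Balaban1985Variational]
Thm 1 (9)–(10), Prop 9 (190); [Balaban1984PropagatorsI] Prop 1.2) — NOT constructed here.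

HONEST FRAMING: calculus∕`Finset`∕`Function.update` bookkeeping over HYPOTHESIS profiles; nothing of Bałaban's analysis is asserted or proved; `SpreadFibreLawH(J)`, LIN″, JEN″,
JVARᵘ-H″, O1ᵘ-H v2.2, S1aᴴ, S3ᴴ, S2α′, S2β, 26243, the five registered stubs, crux 20520 `FluctuationComparisonRegPrIntL` and `YM3TorusSU2` are NOT proved; no summit ∕
sub-problem statement is proved; registry `Lines/semiclassical_s2beta.lean` 3732b7df untouched; rung R3 = SU(2) YM₃ on T³ at fixed lattice data — NOT d = 4, NOT infinite
volume, NOT a mass gap, NOT Clay; the Yang–Mills mass gap is NOT proved.  [folklore]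
-/

set_option autoImplicit false

noncomputable section

namespace Summit.QuantumFields.YangMills.Theorems.OrganTangentPullbackSquareCurvOrgan

open Function Set
open scoped BigOperators
open Literature.MathematicalPhysics.QuantumFieldTheory.Balaban1983to89
open T4CubeChartExp (expPt)
open Summit.QuantumFields.YangMills.Theorems.OrganTangentPullbackSquareCurv (abs_rectDiff_le_curvLetters)
open Summit.QuantumFields.YangMills.Theorems.OrganTangentSeedHClause (eq_update_of_rel corner_fst_zero corner_zero_snd corner_zero_zero)

variable {P : Params} {j : ℕ} [DecidableEq (PBond P j)] {ιP : Type*} [Fintype ιP]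

/-! ## §1 `Finset` algebra: pulling the move sizes out of the structured letter sum -/

/-- Pulling the sizes `a, c` out of the bilinear and the gradient letter sums. [folklore] -/
theorem letterSum_sizes_eq (kP : ιP → ιP → ℝ) (gP : ιP → ℝ) (X Y : ιP → ℝ) (Z : ιP → ℝ) (a c : ℝ) :
    (∑ p, ∑ q, (X p * a) * kP p q * (Y q * c) + ∑ p, gP p * (Z p * a * c))
      = (∑ p, ∑ q, X p * kP p q * Y q + ∑ p, gP p * Z p) * a * c := by
  have h1 : ∑ p, ∑ q, (X p * a) * kP p q * (Y q * c) = (∑ p, ∑ q, X p * kP p q * Y q) * a * c := by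
    rw [Finset.sum_mul, Finset.sum_mul]
    refine Finset.sum_congr rfl fun p _ => ?_
    rw [Finset.sum_mul, Finset.sum_mul]
    refine Finset.sum_congr rfl fun q _ => ?_
    ring
  have h2 : ∑ p, gP p * (Z p * a * c) = (∑ p, gP p * Z p) * a * c := by
    rw [Finset.sum_mul, Finset.sum_mul]
    refine Finset.sum_congr rfl fun p _ => ?_
    ring
  rw [h1, h2]; ring

/-! ## §2 The organ's one-bond exponential square family and its corners -/

/-- The corner `(1, 0)` of the square family is the one-bond move `U·e^{v}@b`. [folklore] -/
theorem sqCorner_one_zero (U : GaugeField P j (Matrix.specialUnitaryGroup (Fin 2) ℂ)) (b b' : PBond P j) (v v' : Fin 3 → ℝ) :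
    update (update U b (U b * expPt ((1 : ℝ) • v))) b' ((update U b (U b * expPt ((1 : ℝ) • v))) b' * expPt ((0 : ℝ) • v'))
      = update U b (U b * expPt v) := by
  rw [corner_fst_zero, one_smul]

/-- The corner `(0, 1)` is the one-bond move `U·e^{v′}@b′`. [folklore] -/
theorem sqCorner_zero_one (U : GaugeField P j (Matrix.specialUnitaryGroup (Fin 2) ℂ)) (b b' : PBond P j) (v v' : Fin 3 → ℝ) :
    update (update U b (U b * expPt ((0 : ℝ) • v))) b' ((update U b (U b * expPt ((0 : ℝ) • v))) b' * expPt ((1 : ℝ) • v'))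
      = update U b' (U b' * expPt v') := by
  rw [corner_zero_snd, one_smul]

/-- The corner `(1, 1)` is the two-bond move `U·e^{v}@b·e^{v′}@b′`. [folklore] -/
theorem sqCorner_one_one (U : GaugeField P j (Matrix.specialUnitaryGroup (Fin 2) ℂ)) (b b' : PBond P j) (v v' : Fin 3 → ℝ) :
    update (update U b (U b * expPt ((1 : ℝ) • v))) b' ((update U b (U b * expPt ((1 : ℝ) • v))) b' * expPt ((1 : ℝ) • v'))
      = update (update U b (U b * expPt v)) b' ((update U b (U b * expPt v)) b' * expPt v') := by
  rw [one_smul, one_smul]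

/-! ## §3 ★★ The `HClauseSq`-shaped pair clause from the differential curvature square clause (shape (s2)) -/

/-- ★★ **JT-CURV, ORGAN EDITION (s2).**  HYPOTHESIS `hsq` — the DIFFERENTIAL CURVATURE SQUARE CLAUSE of `RT` along the organ's one-bond exponential squares: for every
admissible square (`‖v‖, ‖v′‖ ≤ rc·θc`; the four corners `PlaqSmall θc`), with `F s t := RT (sq U b v b′ v′ s t)` on `[0,1]²`: derivative data `F₂` (the `t`-derivative at
`s = 0` and `s = 1`), `F₁₂` (the `s`-derivative of `F₂`), and the structured bound `|F₁₂ s t| ≤ Σ_{p q} α p s t·k̃ p q·α′ q s t + Σ_p g̃ p·γ p s t` with profiles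
`0 ≤ α ≤ KP p b·(‖v‖∕θc)`, `0 ≤ α′ ≤ KP q b′·(‖v′‖∕θc)`, `0 ≤ γ ≤ KP2 p b b′·(‖v‖∕θc)·(‖v′‖∕θc)`.  CONCLUSION — the `HClauseSq θc rc k′ RT` TEXT with the curvature letters
`k′ b b′ := Σ_{p q} KP p b·k̃ p q·KP q b′ + Σ_p g̃ p·KP2 p b b′` (row mass: ✓`OrganTangentPullbackSquareCurv.rowMass_curvLetters`). [folklore] -/
theorem hClauseSq_of_curvSquare {θc rc : ℝ}
    (RT : GaugeField P j (Matrix.specialUnitaryGroup (Fin 2) ℂ) → ℝ)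
    (kP : ιP → ιP → ℝ) (gP : ιP → ℝ) (KP : ιP → PBond P j → ℝ) (KP2 : ιP → PBond P j → PBond P j → ℝ)
    (hk : ∀ p q, 0 ≤ kP p q) (hg : ∀ p, 0 ≤ gP p)
    (hsq : ∀ (b b' : PBond P j) (v v' : Fin 3 → ℝ) (U : GaugeField P j (Matrix.specialUnitaryGroup (Fin 2) ℂ)),
      ‖v‖ ≤ rc * θc → ‖v'‖ ≤ rc * θc → PlaqSmall θc U →
      PlaqSmall θc (update U b (U b * expPt v)) → PlaqSmall θc (update U b' (U b' * expPt v')) →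
      PlaqSmall θc (update (update U b (U b * expPt v)) b' ((update U b (U b * expPt v)) b' * expPt v')) →
      ∃ (F₂ F₁₂ : ℝ → ℝ → ℝ) (α α' γ : ιP → ℝ → ℝ → ℝ),
        (∀ t ∈ Icc (0 : ℝ) 1, HasDerivWithinAt
          (fun t => RT (update (update U b (U b * expPt ((0 : ℝ) • v))) b' ((update U b (U b * expPt ((0 : ℝ) • v))) b' * expPt (t • v'))))
          (F₂ 0 t) (Icc 0 1) t) ∧
        (∀ t ∈ Icc (0 : ℝ) 1, HasDerivWithinAt
          (fun t => RT (update (update U b (U b * expPt ((1 : ℝ) • v))) b' ((update U b (U b * expPt ((1 : ℝ) • v))) b' * expPt (t • v'))))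
          (F₂ 1 t) (Icc 0 1) t) ∧
        (∀ t ∈ Icc (0 : ℝ) 1, ∀ s ∈ Icc (0 : ℝ) 1, HasDerivWithinAt (fun s => F₂ s t) (F₁₂ s t) (Icc 0 1) s) ∧
        (∀ p, ∀ s ∈ Icc (0 : ℝ) 1, ∀ t ∈ Icc (0 : ℝ) 1, 0 ≤ α p s t ∧ α p s t ≤ KP p b * (‖v‖ / θc)) ∧
        (∀ q, ∀ s ∈ Icc (0 : ℝ) 1, ∀ t ∈ Icc (0 : ℝ) 1, 0 ≤ α' q s t ∧ α' q s t ≤ KP q b' * (‖v'‖ / θc)) ∧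
        (∀ p, ∀ s ∈ Icc (0 : ℝ) 1, ∀ t ∈ Icc (0 : ℝ) 1, 0 ≤ γ p s t ∧ γ p s t ≤ KP2 p b b' * (‖v‖ / θc) * (‖v'‖ / θc)) ∧
        (∀ s ∈ Icc (0 : ℝ) 1, ∀ t ∈ Icc (0 : ℝ) 1,
          |F₁₂ s t| ≤ ∑ p, ∑ q, α p s t * kP p q * α' q s t + ∑ p, gP p * γ p s t))
    (b b' : PBond P j) (v v' : Fin 3 → ℝ) (U V W Z : GaugeField P j (Matrix.specialUnitaryGroup (Fin 2) ℂ))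
    (hv : ‖v‖ ≤ rc * θc) (hv' : ‖v'‖ ≤ rc * θc) (hU : PlaqSmall θc U) (hV : PlaqSmall θc V) (hW : PlaqSmall θc W) (hZ : PlaqSmall θc Z)
    (hVU : ∀ e, e ≠ b → V e = U e) (hVb : V b = U b * expPt v) (hWU : ∀ e, e ≠ b' → W e = U e) (hWb : W b' = U b' * expPt v')
    (hZV : ∀ e, e ≠ b' → Z e = V e) (hZb : Z b' = V b' * expPt v') :
    |RT Z - RT V - RT W + RT U| ≤
      (∑ p, ∑ q, KP p b * kP p q * KP q b' + ∑ p, gP p * KP2 p b b') * (‖v‖ / θc) * (‖v'‖ / θc) := by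
  -- the relational corners ARE the square family's corners
  have hVeq : V = update U b (U b * expPt v) := eq_update_of_rel hVU hVb
  have hWeq : W = update U b' (U b' * expPt v') := eq_update_of_rel hWU hWb
  have hZeq : Z = update (update U b (U b * expPt v)) b' ((update U b (U b * expPt v)) b' * expPt v') := by
    have h := eq_update_of_rel hZV hZb
    rw [h, hVeq]
  -- the clause data for this square
  obtain ⟨F₂, F₁₂, α, α', γ, hF0, hF1, hF12, hα, hα', hγ, hbd⟩ :=
    hsq b b' v v' U hv hv' hU (hVeq ▸ hV) (hWeq ▸ hW) (hZeq ▸ hZ)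
  -- the family as a real function of two variables
  set F : ℝ → ℝ → ℝ := fun s t =>
    RT (update (update U b (U b * expPt (s • v))) b' ((update U b (U b * expPt (s • v))) b' * expPt (t • v'))) with hFdef
  have key := abs_rectDiff_le_curvLetters F F₂ F₁₂ (a := 1) (b := 1) zero_le_one zero_le_one hF0 hF1 hF12 kP gP α α' γ
    (fun p => KP p b * (‖v‖ / θc)) (fun q => KP q b' * (‖v'‖ / θc)) (fun p => KP2 p b b' * (‖v‖ / θc) * (‖v'‖ / θc))
    hk hg hα hα' hγ hbd
  -- identify the four corners
  have h11 : F 1 1 = RT Z := by rw [hFdef]; simp only []; rw [sqCorner_one_one, ← hZeq]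
  have h10 : F 1 0 = RT V := by rw [hFdef]; simp only []; rw [sqCorner_one_zero, ← hVeq]
  have h01 : F 0 1 = RT W := by rw [hFdef]; simp only []; rw [sqCorner_zero_one, ← hWeq]
  have h00 : F 0 0 = RT U := by rw [hFdef]; simp only []; rw [corner_zero_zero]
  rw [h11, h10, h01, h00, mul_one, mul_one, letterSum_sizes_eq] at key
  exact key

end Summit.QuantumFields.YangMills.Theorems.OrganTangentPullbackSquareCurvOrgan

end
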